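/-
Copyright: lit-balaban Phase-2 proof seat p08 (gen 7).  Statement-level skeleton of a published paper; no proof claims beyond what
the kernel checks below.
-/
import Literature.MathematicalPhysics.QuantumFieldTheory.BalabanImbrieJaffe1984to88.BIJ88Ineq217Ineq722Torus

/-!
# `BalabanImbrieJaffe1984to88.BIJ88SigmaKernelDkTorus` — T. Bałaban, J. Imbrie, A. Jaffe, *Effective action and cluster properties of
the abelian Higgs model*, Commun. Math. Phys. **114** (1988) 257–315 [BalabanImbrieJaffe1988]: p. 261, **the kernel `σ_k(p₁, p₂)` of
(2.15)–(2.16) ON THE TORI through the multiscale propagator `𝒟_k = Σ_{j<k} H_jC^{(j)}H_j*`** — for p30's `σ_k = sigmaTorus hd w c k` and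
p11's `𝒟_k = DkE P w c k` the matrix entry `σ_k(p₁, p₂) = (σ_ke_{p₂})(p₁)` is `(w·η^{−d})η^{−2}δ_{p₁p₂} − Σ_{j<k} Σ_{b,b′∈T^{(j)}}
u^{(j)}_{p₁}(b)C^{(j)}(b, b′)u^{(j)}_{p₂}(b′)` with `u^{(j)}_p(b) = (w·η^{−d})·(Q^e_k∂^{c}H_je_b)(p)` (the k-fold edge average of the
plaquette derivative of the scale-`j` Landau minimizer's column at `b`) and `C^{(j)}(b, b′) = ⟨e_b, C^{(j)}e_{b′}⟩` — the structure behind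
the bracketed sentence p. 261 *"[The rapid decay of the terms with small j compensates for the scaling factors (L^jη)^{−1}.]"* and the
starting point of (2.16) for the torus σ_k

statement-level skeleton of published theorems with citation tags; proofs where landed; nothing here is a claim about the Yang–Mills mass gap

PDF held: `paper:balaban1988-cmp114-bij-abelian-higgs-effective-action` (journal page = PDF page + 256), p. 261 [PDF 5]; [I] =
[BalabanImbrieJaffe1985] pp. 305, 310, 312 [PDF 7, 12, 14].

CITATION HEADER (lean-in-tree rule).  Part of the lit-balaban TYPED SKELETON (HOME `run/shared/lean/pub/lit-balaban/`), Phase-2 proof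
seat p08 (gen 7), unit `lit-balaban-p08`; WHAT IS REPRODUCED = SKELETON rows **C2.Eq2.15** / **C2.Eq2.16** (owner r18, referee ref-5), kind
«model instance»: the kernel of the torus σ_k in the form used by the proof of (2.16).  Decls of record used BY NAME: p30's `sigmaTorus`,
`QesOp`; p09's `curlOp`; p11's `HkE`, `CE`, `DkE`; gen 7's `BIJ88Eq215Torus.eq215_torus_apply` ((2.15) second member on the tori),
`BIJ85Sigma422Eta.adjoint_QesOp_comp_QesOp`/`inner_QesOp_left` ((2.24), `(Q^{e*}_k)† = (w·η^{−d})Q^e_k`), p31's edge geometry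
`torusEdgeCellsTo` (`Cells.Q` = the k-fold edge average (2.21)).  TAKING line HOME/STATUS.md (gen 7, tenth target).

THE PRINTED TEXT (p. 261 [PDF 5], verbatim): *"The basic quadratic form σ_k arises from integrating out all gauge field fluctuations as in
[2]. It can be written as σ_k = Q^e_k(I − ∂G_{k,Ax}∂*)Q^{e*}_k = Q^e_k(I − ∂𝒟_k∂*)Q^{e*}_k, (2.15) where we use a change of gauge (I.5.2.6)
for the second equality. The properties of σ_k follow from (2.13) and properties of H_k, 𝒟_k, so that |σ_k(p₁,p₂)| ≦ ce^{−c dist(p₁,p₂)} for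
dist(p₁,p₂) ≧ c. (2.16) [The rapid decay of the terms with small j compensates for the scaling factors (L^jη)^{−1}.]"*; [I] (4.4.4) p. 312:
*"𝒟_k = Σ_{j=0}^{k−1} H_jC^{(j)}H_j*. (4.4.4)"*.

WHAT IS PROVED (0 `sorry`, standard axioms; theorems only — proof lane; `k ≤ m + K`, `w > 0`, `c ≠ 0`, `2 ≤ d`):
* §1 (private plumbing) `inner_single_toU`/`inner_single_toEj` (coordinates as pairings with unit vectors), `eq_sum_coord_toEj`,
  `inner_eq_sum_coord` (a pairing of `T^{(j)}`-vectors as a double sum through the matrix `⟨e_b, Te_{b′}⟩`).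
* §2 **`sigmaKernel_eq`** — `σ_k(p₁, p₂) = (w·η^{−d})η^{−2}·δ_{p₁p₂} − ⟨∂*Q^{e*}_ke_{p₁}, 𝒟_k∂*Q^{e*}_ke_{p₂}⟩` ((2.15) second member,
  entrywise; (2.24)); `sigmaKernel_eq_offDiag` (`p₁ ≠ p₂`).
* §3 **`inner_DkE_eq_sum`** — `⟨g₁, 𝒟_kg₂⟩ = Σ_{j<k} ⟨H_j*g₁, C^{(j)}H_j*g₂⟩` ((4.4.4)).
* §4 **`adjoint_HkE_coord`** — the coordinates of `u^{(j)}_p := H_j*∂*Q^{e*}_ke_p`: `u^{(j)}_p(b) = (w·η^{−d})·(Q^e_k(∂^{c}H_je_b))(p)`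
  ((7.2.1) columns, the adjoint pair (2.21)–(2.22) `inner_QesOp_left`, `∂ = √w·∂^{c}`).
* §5 **`sigmaKernel_offDiag_eq_sum`** — for `p₁ ≠ p₂`: `σ_k(p₁, p₂) = −Σ_{j<k} Σ_{b,b′} u^{(j)}_{p₁}(b)·⟨e_b, C^{(j)}e_{b′}⟩·u^{(j)}_{p₂}(b′)`.
HONEST SCOPE.  Identities only (the decay (2.16) itself is the business of the companion file); `U = 1` real abelian fields; torus;
standing range; no `def`, no new named fact; NOT summit progress.  Unit `lit-balaban-p08` (literature-prover-lit-balaban-p08-g7-0), 2026-08-21.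
-/

open scoped BigOperators RealInnerProductSpace

namespace Literature.MathematicalPhysics.QuantumFieldTheory.BalabanImbrieJaffe1984to88.BIJ88SigmaKernelDkTorus

open Balaban1983to89 hiding Site Plaq
open Balaban1983to89.LatticeFieldCalculus
open BIJ88Eq215Torus BIJ88Ineq217LandauTorus BIJ88Ineq217Ineq722Torus
open BIJ85AxialPropagator411 BIJ85Prop521Torus BIJ85Sigma421Torus BIJ85Prop522Torus BIJ85Sigma422Eta BIJ85CellAverages
open BIJ85Eq224Base0 (torusEdgeCellsTo)
-- inside this namespace the bare `Site`/`Plaq` are the `ℤ^d` carriers of the QFT root; the torus ones are renamed: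
open Balaban1983to89 renaming Site → TSite, Plaq → TPlaq

noncomputable section

variable {P : Params}

/-! ## §1  Coordinates and pairings on the Euclidean carriers -/

/-- components are unchanged by `toU`. [folklore] -/
private theorem toU_apply' (k : ℕ) (g : TPlaq P k → ℝ) (p : TPlaq P k) : toU P k g p = g p := rfl

/-- components are unchanged by `toEj`. [folklore] -/
private theorem toEj_apply' (j : ℕ) (B : PBond P j → ℝ) (b : PBond P j) : toEj P j B b = B b := rfl

/-- `⟨e_p, f⟩ = f(p)` on the unit-lattice plaquette space. [folklore] -/
private theorem inner_single_toU (k : ℕ) (p : TPlaq P k) (f : UnitPlaqSpace P k) : ⟪toU P k (Pi.single p 1), f⟫ = f p := by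
  rw [PiLp.inner_apply, Finset.sum_eq_single p]
  · rw [RCLike.inner_apply, RCLike.conj_to_real, toU_apply', Pi.single_eq_same, mul_one]
  · intro q _ hq
    rw [RCLike.inner_apply, RCLike.conj_to_real, toU_apply', Pi.single_eq_of_ne hq, mul_zero]
  · intro h; exact absurd (Finset.mem_univ p) h

/-- `⟨e_b, u⟩ = u(b)` on the `T^{(j)}` bond space. [folklore] -/
private theorem inner_single_toEj (j : ℕ) (b : PBond P j) (u : CoarseSpace P j) : ⟪toEj P j (Pi.single b 1), u⟫ = u b := by
  rw [PiLp.inner_apply, Finset.sum_eq_single b]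
  · rw [RCLike.inner_apply, RCLike.conj_to_real, toEj_apply', Pi.single_eq_same, mul_one]
  · intro q _ hq
    rw [RCLike.inner_apply, RCLike.conj_to_real, toEj_apply', Pi.single_eq_of_ne hq, mul_zero]
  · intro h; exact absurd (Finset.mem_univ b) h

/-- a `T^{(j)}`-vector is the sum of its coordinates times the unit vectors. [folklore] -/
private theorem eq_sum_coord_toEj (j : ℕ) (u : CoarseSpace P j) : u = ∑ b, u b • toEj P j (Pi.single b 1) := by
  have h : WithLp.ofLp u = ∑ b, u b • (Pi.single b (1 : ℝ) : PBond P j → ℝ) := by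
    funext i
    rw [Finset.sum_apply, Finset.sum_eq_single i]
    · rw [Pi.smul_apply, Pi.single_eq_same, smul_eq_mul, mul_one]
    · intro b _ hb
      rw [Pi.smul_apply, Pi.single_eq_of_ne (Ne.symm hb), smul_zero]
    · intro hi; exact absurd (Finset.mem_univ i) hi
  have h2 : (∑ b, u b • toEj P j (Pi.single b 1)) = toEj P j (∑ b, u b • (Pi.single b (1 : ℝ) : PBond P j → ℝ)) := by
    rw [map_sum]; simp only [map_smul]
  rw [h2, ← h]
  rfl

/-- **a pairing through the matrix**: `⟨u₁, Tu₂⟩ = Σ_{b,b′} u₁(b)·⟨e_b, Te_{b′}⟩·u₂(b′)` for a linear map `T` of the `T^{(j)}` bond space.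
[folklore] -/
private theorem inner_eq_sum_coord (j : ℕ) (T : CoarseSpace P j →ₗ[ℝ] CoarseSpace P j) (u₁ u₂ : CoarseSpace P j) :
    ⟪u₁, T u₂⟫ = ∑ b, ∑ b', u₁ b * ⟪toEj P j (Pi.single b 1), T (toEj P j (Pi.single b' 1))⟫ * u₂ b' := by
  conv_lhs => rw [eq_sum_coord_toEj j u₁, eq_sum_coord_toEj j u₂]
  rw [map_sum, sum_inner]
  refine Finset.sum_congr rfl fun b _ => ?_
  rw [inner_sum]
  refine Finset.sum_congr rfl fun b' _ => ?_
  rw [map_smul, real_inner_smul_left, real_inner_smul_right]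
  ring

/-! ## §2  The kernel of σ_k through `𝒟_k`: (2.15), second member, entrywise -/

/-- **`σ_k(p₁, p₂) = (w·η^{−d})η^{−2}δ_{p₁p₂} − ⟨∂*Q^{e*}_ke_{p₁}, 𝒟_k∂*Q^{e*}_ke_{p₂}⟩`** — the matrix entry `(σ_ke_{p₂})(p₁)` of p30's torus
σ_k from the second member of (2.15) (`eq215_torus_apply`) and (2.24) `(Q^{e*}_k)†Q^{e*}_k = (w·η^{−d})η^{−2}I` (`adjoint_QesOp_comp_QesOp`).
[cite: BalabanImbrieJaffe1988, (2.15) p.261] -/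
theorem sigmaKernel_eq (hd : 2 ≤ P.d) {k : ℕ} (hk : k ≤ P.m + P.K) {c : ℝ} (hc : c ≠ 0) {w : ℝ} (hw : 0 < w) (p₁ p₂ : TPlaq P k) :
    sigmaTorus (P := P) hd w c k (toU P k (Pi.single p₂ 1)) p₁ =
      w * ((P.eta k)⁻¹) ^ P.d * ((P.eta k)⁻¹) ^ 2 * (Pi.single p₂ (1 : ℝ) : TPlaq P k → ℝ) p₁ -
        ⟪LinearMap.adjoint (curlOp (P := P) w c) (QesOp (P := P) hd w k (toU P k (Pi.single p₁ 1))),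
          DkE P w c k (LinearMap.adjoint (curlOp (P := P) w c) (QesOp (P := P) hd w k (toU P k (Pi.single p₂ 1))))⟫ := by
  rw [eq215_torus_apply hd hk hc hw, map_sub]
  have h1 : LinearMap.adjoint (QesOp (P := P) hd w k) (QesOp (P := P) hd w k (toU P k (Pi.single p₂ 1))) =
      (w * ((P.eta k)⁻¹) ^ P.d * ((P.eta k)⁻¹) ^ 2) • toU P k (Pi.single p₂ 1) := by
    rw [← LinearMap.comp_apply, adjoint_QesOp_comp_QesOp hd hk hw.le, LinearMap.smul_apply, LinearMap.id_apply]
  have h2 : LinearMap.adjoint (QesOp (P := P) hd w k) (curlOp (P := P) w c (DkE P w c k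
      (LinearMap.adjoint (curlOp (P := P) w c) (QesOp (P := P) hd w k (toU P k (Pi.single p₂ 1)))))) p₁ =
      ⟪LinearMap.adjoint (curlOp (P := P) w c) (QesOp (P := P) hd w k (toU P k (Pi.single p₁ 1))),
        DkE P w c k (LinearMap.adjoint (curlOp (P := P) w c) (QesOp (P := P) hd w k (toU P k (Pi.single p₂ 1))))⟫ := by
    rw [← inner_single_toU k p₁, LinearMap.adjoint_inner_right, ← LinearMap.adjoint_inner_left]
  rw [PiLp.sub_apply, h1, h2, PiLp.smul_apply, smul_eq_mul, toU_apply']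

/-- **off the diagonal**: `σ_k(p₁, p₂) = −⟨∂*Q^{e*}_ke_{p₁}, 𝒟_k∂*Q^{e*}_ke_{p₂}⟩` for `p₁ ≠ p₂`. [cite: BalabanImbrieJaffe1988, (2.15) p.261] -/
theorem sigmaKernel_eq_offDiag (hd : 2 ≤ P.d) {k : ℕ} (hk : k ≤ P.m + P.K) {c : ℝ} (hc : c ≠ 0) {w : ℝ} (hw : 0 < w)
    {p₁ p₂ : TPlaq P k} (hne : p₁ ≠ p₂) :
    sigmaTorus (P := P) hd w c k (toU P k (Pi.single p₂ 1)) p₁ =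
      -⟪LinearMap.adjoint (curlOp (P := P) w c) (QesOp (P := P) hd w k (toU P k (Pi.single p₁ 1))),
          DkE P w c k (LinearMap.adjoint (curlOp (P := P) w c) (QesOp (P := P) hd w k (toU P k (Pi.single p₂ 1))))⟫ := by
  rw [sigmaKernel_eq hd hk hc hw, Pi.single_eq_of_ne hne, mul_zero, zero_sub]

/-! ## §3  (4.4.4): `⟨g₁, 𝒟_kg₂⟩ = Σ_{j<k} ⟨H_j*g₁, C^{(j)}H_j*g₂⟩` -/

/-- **(4.4.4) as a form**: `⟨g₁, 𝒟_kg₂⟩_η = Σ_{j<k} ⟨H_j*g₁, C^{(j)}H_j*g₂⟩` (`H_j*` the Euclidean adjoint of p11's `HkE P w c j`).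
[cite: BalabanImbrieJaffe1985, (4.4.4) p.312] -/
theorem inner_DkE_eq_sum (w c : ℝ) (k : ℕ) (g₁ g₂ : BondSpace P) :
    ⟪g₁, DkE P w c k g₂⟫ = ∑ j ∈ Finset.range k,
      ⟪LinearMap.adjoint (HkE P w c j) g₁, CE P w c j (LinearMap.adjoint (HkE P w c j) g₂)⟫ := by
  unfold DkE
  rw [LinearMap.sum_apply, inner_sum]
  refine Finset.sum_congr rfl fun j _ => ?_
  rw [LinearMap.comp_apply, LinearMap.comp_apply, ← LinearMap.adjoint_inner_left]

/-! ## §4  The coordinates of `u^{(j)}_p = H_j*∂*Q^{e*}_ke_p`: edge averages of the columns `∂^{c}H_je_b` -/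

/-- `Q(aF) = aQ(F)` for a cell average. [cite: BalabanImbrieJaffe1985, (2.21) p.305] -/
private theorem cellsQ_const_mul' (G : Cells) (a : ℝ) (F : G.F → ℝ) (c : G.C) :
    G.Q (fun p => a * F p) c = a * G.Q F c := by
  rw [Cells.Q, Cells.Q, ← Finset.mul_sum]; ring

/-- **THE COORDINATES OF `u^{(j)}_p := H_j*∂*Q^{e*}_ke_p`**: `u^{(j)}_p(b) = (w·η^{−d})·(Q^e_k(∂^{c}H_je_b))(p)` — the k-fold edge average
(2.21) (`Cells.Q` of p31's `torusEdgeCellsTo P 0 k k`) at the unit plaquette `p` of the η-plaquette field `∂^{c}H_je_b` (the curl of the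
column of the scale-`j` Landau minimizer at the unit bond `b ∈ T^{(j)}`); by `⟨e_b, H_j*∂*Q^{e*}_ke_p⟩ = ⟨∂H_je_b, Q^{e*}_ke_p⟩` and the
adjoint pair (2.21)–(2.22) (`inner_QesOp_left`), `∂ = √w·∂^{c}`. [cite: BalabanImbrieJaffe1985, (2.21)–(2.22) p.305] -/
theorem adjoint_HkE_coord (hd : 2 ≤ P.d) {k : ℕ} (hk : k ≤ P.m + P.K) {w : ℝ} (hw : 0 ≤ w) (c : ℝ) (j : ℕ) (p : TPlaq P k)
    (b : PBond P j) :
    LinearMap.adjoint (HkE P w c j)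
        (LinearMap.adjoint (curlOp (P := P) w c) (QesOp (P := P) hd w k (toU P k (Pi.single p 1)))) b =
      w * ((P.eta k)⁻¹) ^ P.d *
        (torusEdgeCellsTo P 0 k k (Nat.zero_add k) hd).Q
          (fun q => curl c (WithLp.ofLp (HkE P w c j (toEj P j (Pi.single b 1)))) q) p := by
  rw [← inner_single_toEj j b, LinearMap.adjoint_inner_right, LinearMap.adjoint_inner_right, real_inner_comm,
    inner_QesOp_left hd hk w, Finset.sum_eq_single p]
  · rw [toU_apply', Pi.single_eq_same, one_mul]
    have hF : (fun q => curlOp (P := P) w c (HkE P w c j (toEj P j (Pi.single b 1))) q) =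
        fun q => Real.sqrt w * curl c (WithLp.ofLp (HkE P w c j (toEj P j (Pi.single b 1)))) q := by
      funext q; rfl
    rw [hF, cellsQ_const_mul']
    rw [← mul_assoc, mul_right_comm (Real.sqrt w) _ (Real.sqrt w), Real.mul_self_sqrt hw]
  · intro q _ hq
    rw [toU_apply', Pi.single_eq_of_ne hq, zero_mul]
  · intro h; exact absurd (Finset.mem_univ p) h

/-! ## §5  The off-diagonal kernel of σ_k as a multiscale double sum -/

/-- **THE KERNEL OF σ_k THROUGH THE KERNELS OF `∂H_j` AND `C^{(j)}`**: for `p₁ ≠ p₂`,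
`σ_k(p₁, p₂) = −Σ_{j<k} Σ_{b,b′∈T^{(j)}} u^{(j)}_{p₁}(b)·C^{(j)}(b, b′)·u^{(j)}_{p₂}(b′)`, `u^{(j)}_p(b) = (w·η^{−d})(Q^e_k∂^{c}H_je_b)(p)`
(`adjoint_HkE_coord`), `C^{(j)}(b, b′) = ⟨e_b, C^{(j)}e_{b′}⟩` the matrix of p11's `CE P w c j` — the multiscale structure behind p. 261's
*"[The rapid decay of the terms with small j compensates for the scaling factors (L^jη)^{−1}.]"*. [cite: BalabanImbrieJaffe1988, (2.16) p.261] -/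
theorem sigmaKernel_offDiag_eq_sum (hd : 2 ≤ P.d) {k : ℕ} (hk : k ≤ P.m + P.K) {c : ℝ} (hc : c ≠ 0) {w : ℝ} (hw : 0 < w)
    {p₁ p₂ : TPlaq P k} (hne : p₁ ≠ p₂) :
    sigmaTorus (P := P) hd w c k (toU P k (Pi.single p₂ 1)) p₁ =
      -∑ j ∈ Finset.range k, ∑ b : PBond P j, ∑ b' : PBond P j,
        LinearMap.adjoint (HkE P w c j)
            (LinearMap.adjoint (curlOp (P := P) w c) (QesOp (P := P) hd w k (toU P k (Pi.single p₁ 1)))) b *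
          ⟪toEj P j (Pi.single b 1), CE P w c j (toEj P j (Pi.single b' 1))⟫ *
          LinearMap.adjoint (HkE P w c j)
            (LinearMap.adjoint (curlOp (P := P) w c) (QesOp (P := P) hd w k (toU P k (Pi.single p₂ 1)))) b' := by
  rw [sigmaKernel_eq_offDiag hd hk hc hw hne, inner_DkE_eq_sum]
  congr 1
  refine Finset.sum_congr rfl fun j _ => ?_
  rw [inner_eq_sum_coord]

end

end Literature.MathematicalPhysics.QuantumFieldTheory.BalabanImbrieJaffe1984to88.BIJ88SigmaKernelDkTorus
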